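import Summits.BirchSwinnertonDyer.BirchSwinnertonDyer.Theorems.PrintCf2SplitBadTwoCMPrimaryModule
import Summits.BirchSwinnertonDyer.BirchSwinnertonDyer.Theorems.PrintCf2SplitBadEisensteinTwoOrdinaryFiltrationTransport
import HarnessLib

/-!
# Crux `PrintCf2.SplitBadTwoRankOneOfFacts` (item stmt-BirchSwinnertonDyer-20368), road α over the CM field:
# the two CM-primary summands `E[𝔮^∞]`, `E[𝔮̄^∞]` AGAINST A GREENBERG DATUM at a place `𝔭` — the local dichotomy

Cell `bsd-print-cf2`, width seat `bsd-line-cf2-p1-w2` g8; `--supports stmt-BirchSwinnertonDyer-20368` (helper). HONEST FRAMING: nothing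
here closes a crux or a stub; BSD is not proved by any of this; no summit statement is proved by this seat. THEOREMS ONLY (no
definition, no named fact, no `sorry`). This is FILE 1 of 2 (the engine and the datum-relative dichotomy); FILE 2
`PrintCf2SplitBadTwoCMPrimaryLocalPinning.lean` supplies the datum (p640618's chain) and the inertia witness at a degree-one
`𝔭 ∣ 2` and states the pinning theorems road α consumes.

SETTING. `W/ℚ` elliptic with `j = −3375`, `K` a number field with `θ² = −7`, `π ∈ End_K(E_K)` with `π² = π − 2`, `r ∈ ℤ₂` a root
of `X² − X + 2`; the NAMED discrete `Γ_K`-modules `E[𝔮_r^∞] := (W.baseChange K).endEigenPrimaryTorsion 2 π r` and `E[𝔮_{1−r}^∞]`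
(p646843; structure p647665: complementary, `2`-divisible, cyclic levels of order `2^k`, `Γ_K` acting by level-wise integer
scalars, `ψ_𝔮·ψ_𝔮̄ = ε`). A GREENBERG DATUM at a place `𝔭` of `K` is a subgroup `C ≤ E_K[2^∞]` with a unit `α` carrying the two
SIGNED clauses of p640618's `stub_ordinaryFiltrationAtTwo` for the local group `Γ_{K_𝔭}`: every `σ` of Frobenius degree `n`
acts on `E[2^∞] ⧸ C` as `±αⁿ` (graded) and on `C[2^k]` as `±ε(res σ)·α^{−n}`.

* §1 `2`-adic bookkeeping (`zsmul_eq_zsmul_of_sub_mem_span_two`, `eq_zero_of_forall_mem_span_two`,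
  `intCast_mem_span_two_iff_dvd`, the two roots `eq_or_eq_one_sub_of_root_two` / `unit_root_eq_one_sub` / `root_ne_one_sub_two`).
* §2 the engine: `endEigenPrimaryTorsion_two_exists_inf_le_torsionBy` (a summand NOT inside `C` meets `C` in a piece killed by
  `2^a`), `endEigenPrimaryTorsion_two_smul_eq_of_not_le` (such a summand carries the QUOTIENT character — graded-to-pointwise
  transfer through `2^a`-divisibility), `endEigenPrimaryTorsion_two_sq_eq_cyclotomicCharacter` (ONE scalar `t` for `g` on BOTH
  summands forces `t² = ε(g)`), `endEigenPrimaryTorsion_two_exists_smul_ne` (a scalar `t ≠ ±1` moves some point off `±` itself).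
* §3 **`endEigenPrimaryTorsion_two_localTypes_of_datum`** — given a datum `(C, α)` at `𝔭` and an inertia element `τ₀ ∈ Γ_{K_𝔭}`
  with `ε(res τ₀) ≠ 1`: the roots are ORDERED `(ρ, ρ')` with `E[𝔮_ρ^∞] ⊄ C`, `E[𝔮_{ρ'}^∞] ≤ C`, (U) `σ` of Frobenius degree `n`
  acts on `E[𝔮_ρ^∞][2^k]` as any `N ≡ ±αⁿ` (UNRAMIFIED-TWIST type), (R) on `E[𝔮_{ρ'}^∞][2^k]` as any `N ≡ ±ε(res σ)α^{−n}`
  (KERNEL-OF-REDUCTION type). Proof: `C = ⊤` or «both summands ⊄ C» would give one scalar for `τ₀` on both summands, whence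
  `ε(res τ₀) = 1` by §2. **`eq_endEigenPrimaryTorsion_two_of_divisible`** — a `2`-divisible datum IS `E[𝔮_{ρ'}^∞]`.

This is Deuring/Serre–Tate bookkeeping (Rubin, LNM 1716, §3: Lemma 3.6 (ii) `E[𝔭ⁿ] ⊂ E₁`; Thm. 3.15 (ii), Cor. 3.17
`K(E[𝔭̄ⁿ])/K` unramified at `𝔭`) for the additive twists of `49a1`, in the kernel's currency; beyond-print theorem: no.

References: K. Rubin, LNM 1716 (1999), §2–3, Prop. 5.4; R. Greenberg, LNM 1716 (1999) §2 pp. 62–63, 70; [SilvermanAEC2009] III.8.1.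
-/

noncomputable section

open scoped Classical

set_option linter.dupNamespace false
set_option autoImplicit false

namespace Summit.BirchSwinnertonDyer.BirchSwinnertonDyer.Theorems.PrintCf2.CMPrimes

/-! ## §1 `2`-adic bookkeeping -/
section Padic

/-- Two integers approximating the same `2`-adic integer to order `2^k` act alike on an element killed by `2^k`. [folklore] -/
theorem zsmul_eq_zsmul_of_sub_mem_span_two {M : Type*} [AddCommGroup M] {k : ℕ} {x : M} (hx : 2 ^ k • x = 0)
    {t : ℤ_[2]} {N N' : ℤ} (hN : ((N : ℤ_[2]) - t) ∈ (Ideal.span {(2 : ℤ_[2]) ^ k} : Ideal ℤ_[2]))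
    (hN' : ((N' : ℤ_[2]) - t) ∈ (Ideal.span {(2 : ℤ_[2]) ^ k} : Ideal ℤ_[2])) : N • x = N' • x :=
  zsmul_eq_zsmul_of_pow_dvd_sub (p := 2) hx (pow_dvd_sub_of_sub_mem_span (p := 2) hN hN')

/-- A `2`-adic integer lying in every `2^k ℤ₂` is `0`. [folklore] -/
theorem eq_zero_of_forall_mem_span_two {t : ℤ_[2]}
    (h : ∀ k : ℕ, t ∈ (Ideal.span {(2 : ℤ_[2]) ^ k} : Ideal ℤ_[2])) : t = 0 := by
  by_contra ht
  have hk : ‖t‖ ≤ ((2 : ℕ) : ℝ) ^ (-((t.valuation + 1 : ℕ) : ℤ)) :=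
    (PadicInt.norm_le_pow_iff_mem_span_pow _ _).mpr (h (t.valuation + 1))
  rw [PadicInt.norm_eq_zpow_neg_valuation ht] at hk
  have hlt : ((2 : ℕ) : ℝ) ^ (-((t.valuation + 1 : ℕ) : ℤ)) < ((2 : ℕ) : ℝ) ^ (-(t.valuation : ℤ)) :=
    zpow_lt_zpow_right₀ (by norm_num) (by push_cast; omega)
  exact absurd (lt_of_lt_of_le hlt hk) (lt_irrefl _)

/-- `(N : ℤ₂) ∈ 2^k ℤ₂` iff `2^k ∣ N`. [folklore] -/
theorem intCast_mem_span_two_iff_dvd (N : ℤ) (k : ℕ) :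
    ((N : ℤ_[2]) ∈ (Ideal.span {(2 : ℤ_[2]) ^ k} : Ideal ℤ_[2])) ↔ (2 ^ k : ℤ) ∣ N := by
  have h := PadicInt.norm_le_pow_iff_mem_span_pow (p := 2) (N : ℤ_[2]) k
  rw [PadicInt.norm_int_le_pow_iff_dvd] at h
  exact_mod_cast h.symm

/-- The two roots of `X² − X + 2` in `ℤ₂`: if `α² = α − 2` and `r² = r − 2` then `α = r` or `α = 1 − r`
(`(α − r)(α − (1 − r)) = (α² − α) + (r − r²) = −2 + 2`). [folklore] -/
theorem eq_or_eq_one_sub_of_root_two {α r : ℤ_[2]} (hα : α * α = α - 2) (hr : r * r = r - 2) :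
    α = r ∨ α = 1 - r := by
  have h : (α - r) * (α - (1 - r)) = 0 := by linear_combination hα - hr
  rcases mul_eq_zero.mp h with h | h
  · exact Or.inl (sub_eq_zero.mp h)
  · exact Or.inr (sub_eq_zero.mp h)

/-- The UNIT root of `X² − X + 2` is `1 − r₀` for the non-unit root `r₀` (`‖r₀‖ < 1`): a unit `α` with `α² = α − 2` equals
`1 − r₀`. [folklore] -/
theorem unit_root_eq_one_sub {α : ℤ_[2]ˣ} (hα : (α : ℤ_[2]) * α = α - 2) {r : ℤ_[2]} (hr : r * r = r - 2)
    (hrn : ‖r‖ < 1) : (α : ℤ_[2]) = 1 - r := by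
  rcases eq_or_eq_one_sub_of_root_two hα hr with h | h
  · exact absurd (h ▸ PadicInt.isUnit_iff.mp α.isUnit) (ne_of_lt hrn)
  · exact h

/-- `r ≠ 1 − r` for a root of `X² − X + 2` in `ℤ₂` (`2r = 1` is impossible: `‖2r‖ < 1`). [folklore] -/
theorem root_ne_one_sub_two {r : ℤ_[2]} (hr : r * r = r - 2) : r ≠ 1 - r := by
  intro h
  have hu := (two_dvd_or_two_dvd_one_sub_of_root hr).2
  rw [← h, sub_self] at hu
  exact not_isUnit_zero hu

end Padic

/-! ## §2 The two CM summands against a Greenberg datum: core lemmas -/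
section Core

open WeierstrassCurve Literature.NumberTheory.EllipticCurves Literature.NumberTheory.GaloisRepresentations Field NumberField
  IsDedekindDomain

variable (W : WeierstrassCurve ℚ) [W.IsElliptic] (K : Type) [Field K] [NumberField K]

/-- Iterated `2`-divisibility of a CM summand: every `x ∈ E[𝔮^∞]` is `2^n y` for some `y ∈ E[𝔮^∞]`. [cite: Rubin1999, §2 and Prop. 5.4] -/
theorem endEigenPrimaryTorsion_two_exists_pow_nsmul_eq (hj : W.j = -3375) {θ : K} (hθ : θ ^ 2 = -7)
    (π : (W.baseChange K).endRing) (hrel : (π : AddMonoid.End (W.baseChange K).geomPoints) * π = π - 2)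
    {ρ : ℤ_[2]} (hρ : ρ * ρ = ρ - 2) (n : ℕ) :
    ∀ x ∈ (W.baseChange K).endEigenPrimaryTorsion 2 π ρ,
      ∃ y ∈ (W.baseChange K).endEigenPrimaryTorsion 2 π ρ, 2 ^ n • y = x := by
  obtain ⟨-, -, -, -, hdiv, -, -, -⟩ := endEigenPrimaryTorsion_two_structure W hj K hθ π hrel hρ
  induction n with
  | zero => intro x hx; exact ⟨x, hx, by rw [pow_zero, one_nsmul]⟩
  | succ n ih =>
    intro x hx
    obtain ⟨y, hy, rfl⟩ := ih x hx
    obtain ⟨z, hz, rfl⟩ := hdiv y hy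
    exact ⟨z, hz, by rw [pow_succ', mul_nsmul]⟩

/-- **A CM summand meets a subgroup missing one of its points in a bounded finite piece.** If `E[𝔮^∞] ⊄ C` then for some `a`,
every point of `C ∩ E[𝔮^∞]` is killed by `2^a` (each level `E[𝔮^∞][2^b]` is cyclic of order `2^b`, generated by any of its
points of exact order `2^b`). [cite: Rubin1999, §2 and Prop. 5.4] -/
theorem endEigenPrimaryTorsion_two_exists_inf_le_torsionBy (hj : W.j = -3375) {θ : K} (hθ : θ ^ 2 = -7)
    (π : (W.baseChange K).endRing) (hrel : (π : AddMonoid.End (W.baseChange K).geomPoints) * π = π - 2)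
    {ρ : ℤ_[2]} (hρ : ρ * ρ = ρ - 2) {C : AddSubgroup ((W.baseChange K).geomPrimaryTorsion 2)}
    (hnot : ¬ (W.baseChange K).endEigenPrimaryTorsion 2 π ρ ≤ C) :
    ∃ a : ℕ, ∀ y ∈ (W.baseChange K).endEigenPrimaryTorsion 2 π ρ, y ∈ C → 2 ^ a • y = 0 := by
  set M := (W.baseChange K).endEigenPrimaryTorsion 2 π ρ with hM
  obtain ⟨-, -, -, -, -, hcard, -, -⟩ := endEigenPrimaryTorsion_two_structure W hj K hθ π hrel hρ
  obtain ⟨x₀, hx₀M, hx₀C⟩ := SetLike.not_le_iff_exists.mp hnot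
  obtain ⟨a, ha⟩ : ∃ a : ℕ, 2 ^ a • x₀ = 0 := by
    obtain ⟨a, ha⟩ := (AddCommGroup.mem_primaryComponent).mp x₀.2
    exact ⟨a, Subtype.ext (by rw [AddSubmonoidClass.coe_nsmul, ZeroMemClass.coe_zero]; exact ha)⟩
  refine ⟨a, fun y hyM hyC ↦ ?_⟩
  by_contra hy
  obtain ⟨m, hm⟩ : ∃ m : ℕ, 2 ^ m • y = 0 := by
    obtain ⟨m, hm⟩ := (AddCommGroup.mem_primaryComponent).mp y.2
    exact ⟨m, Subtype.ext (by rw [AddSubmonoidClass.coe_nsmul, ZeroMemClass.coe_zero]; exact hm)⟩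
  obtain ⟨b, -, hb⟩ := (Nat.dvd_prime_pow Nat.prime_two).mp (addOrderOf_dvd_of_nsmul_eq_zero hm)
  -- `ℤ y = M[2^b]`
  have hle : AddSubgroup.zmultiples y ≤ M ⊓ AddSubgroup.torsionBy _ (2 ^ b : ℕ) := by
    rw [AddSubgroup.zmultiples_le]
    exact ⟨hyM, AddSubgroup.torsionBy.nsmul_iff.mpr (hb ▸ addOrderOf_nsmul_eq_zero y)⟩
  haveI : Finite ↥(M ⊓ AddSubgroup.torsionBy _ (2 ^ b : ℕ)) :=
    Nat.finite_of_card_ne_zero (by rw [hcard b]; positivity)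
  have heq : AddSubgroup.zmultiples y = M ⊓ AddSubgroup.torsionBy _ (2 ^ b : ℕ) :=
    AddSubgroup.eq_of_le_of_card_ge hle (by rw [hcard b, Nat.card_zmultiples, hb])
  -- `a ≤ b` since `2^a y ≠ 0`
  have hab : a ≤ b := by
    by_contra hlt
    exact hy (addOrderOf_dvd_iff_nsmul_eq_zero.mp (hb ▸ pow_dvd_pow 2 (not_le.mp hlt).le))
  have hx₀b : 2 ^ b • x₀ = 0 := by
    obtain ⟨c, hc⟩ := Nat.exists_eq_add_of_le hab
    rw [hc, pow_add, mul_nsmul, ha, nsmul_zero]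
  have hx₀mem : x₀ ∈ M ⊓ AddSubgroup.torsionBy _ (2 ^ b : ℕ) :=
    ⟨hx₀M, AddSubgroup.torsionBy.nsmul_iff.mpr hx₀b⟩
  rw [← heq, AddSubgroup.mem_zmultiples_iff] at hx₀mem
  obtain ⟨c, rfl⟩ := hx₀mem
  exact hx₀C (C.zsmul_mem hyC c)

/-- **The summand NOT contained in the Greenberg datum carries the QUOTIENT character** (graded-to-pointwise transfer). If
`E[𝔮^∞] ⊄ C` and an element `g ∈ Γ_K` acts on `E[2^∞] ⧸ C` as the `2`-adic integer `t` in the graded sense (`2^k x ∈ C ⟹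
g x − N x ∈ C` for `N ≡ t (mod 2^k)`), then `g` acts on `E[𝔮^∞][2^k]` as any `N ≡ t (mod 2^k)`: lift `x = 2^a y` inside
`E[𝔮^∞]`, apply the graded clause at level `k + a`, and kill the error in `C ∩ E[𝔮^∞] ⊆ E[𝔮^∞][2^a]`.
[cite: Rubin1999, §3 Thm. 3.15 (ii) and Cor. 3.17] -/
theorem endEigenPrimaryTorsion_two_smul_eq_of_not_le (hj : W.j = -3375) {θ : K} (hθ : θ ^ 2 = -7)
    (π : (W.baseChange K).endRing) (hrel : (π : AddMonoid.End (W.baseChange K).geomPoints) * π = π - 2)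
    {ρ : ℤ_[2]} (hρ : ρ * ρ = ρ - 2) {C : AddSubgroup ((W.baseChange K).geomPrimaryTorsion 2)}
    (hnot : ¬ (W.baseChange K).endEigenPrimaryTorsion 2 π ρ ≤ C) (g : absoluteGaloisGroup K) {t : ℤ_[2]}
    (hquot : ∀ (k : ℕ) (x : (W.baseChange K).geomPrimaryTorsion 2), 2 ^ k • x ∈ C →
      ∀ N : ℤ, ((N : ℤ_[2]) - t) ∈ (Ideal.span {(2 : ℤ_[2]) ^ k} : Ideal ℤ_[2]) → g • x - N • x ∈ C) :
    ∀ (k : ℕ), ∀ x ∈ (W.baseChange K).endEigenPrimaryTorsion 2 π ρ, 2 ^ k • x = 0 →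
      ∀ N : ℤ, ((N : ℤ_[2]) - t) ∈ (Ideal.span {(2 : ℤ_[2]) ^ k} : Ideal ℤ_[2]) → g • x = N • x := by
  set M := (W.baseChange K).endEigenPrimaryTorsion 2 π ρ with hM
  obtain ⟨a, ha⟩ := endEigenPrimaryTorsion_two_exists_inf_le_torsionBy W K hj hθ π hrel hρ hnot
  intro k x hxM hxk N hN
  obtain ⟨y, hyM, rfl⟩ := endEigenPrimaryTorsion_two_exists_pow_nsmul_eq W K hj hθ π hrel hρ a x hxM
  have hy0 : 2 ^ (k + a) • y = 0 := by rw [pow_add, mul_comm, mul_nsmul, hxk]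
  obtain ⟨N', hN'⟩ := exists_int_sub_mem_span (p := 2) t (k + a)
  have hmemC : g • y - N' • y ∈ C := hquot (k + a) y (by rw [hy0]; exact C.zero_mem) N' hN'
  have hmemM : g • y - N' • y ∈ M := M.sub_mem (smul_mem_endEigenPrimaryTorsion π ρ g hyM) (M.zsmul_mem hyM N')
  have h2a : 2 ^ a • (g • y - N' • y) = 0 := ha _ hmemM hmemC
  rw [nsmul_sub, sub_eq_zero, smul_comm (2 ^ a) g y, smul_comm (2 ^ a) N' y] at h2a
  rw [h2a]
  refine zsmul_eq_zsmul_of_sub_mem_span_two hxk ?_ hN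
  exact Ideal.span_singleton_le_span_singleton.mpr (pow_dvd_pow _ (Nat.le_add_right k a)) hN'

/-- **`t² = ε(g)` when ONE `2`-adic scalar `t` serves for `g` on BOTH summands** (from `ψ_𝔮·ψ_𝔮̄ = ε` at every level).
[cite: SilvermanAEC2009, Prop. III.8.1 (a)–(d)] -/
theorem endEigenPrimaryTorsion_two_sq_eq_cyclotomicCharacter (hj : W.j = -3375) {θ : K} (hθ : θ ^ 2 = -7)
    (π : (W.baseChange K).endRing) (hrel : (π : AddMonoid.End (W.baseChange K).geomPoints) * π = π - 2)
    {r : ℤ_[2]} (hr : r * r = r - 2) (g : absoluteGaloisGroup K) {t : ℤ_[2]}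
    (h₁ : ∀ (k : ℕ), ∀ x ∈ (W.baseChange K).endEigenPrimaryTorsion 2 π r, 2 ^ k • x = 0 →
      ∀ N : ℤ, ((N : ℤ_[2]) - t) ∈ (Ideal.span {(2 : ℤ_[2]) ^ k} : Ideal ℤ_[2]) → g • x = N • x)
    (h₂ : ∀ (k : ℕ), ∀ x ∈ (W.baseChange K).endEigenPrimaryTorsion 2 π (1 - r), 2 ^ k • x = 0 →
      ∀ N : ℤ, ((N : ℤ_[2]) - t) ∈ (Ideal.span {(2 : ℤ_[2]) ^ k} : Ideal ℤ_[2]) → g • x = N • x) :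
    t * t = ((GaloisRep.cyclotomicCharacter K 2 g : ℤ_[2]ˣ) : ℤ_[2]) := by
  rw [← sub_eq_zero]
  refine eq_zero_of_forall_mem_span_two fun k ↦ ?_
  obtain ⟨N, hN⟩ := exists_int_sub_mem_span (p := 2) t k
  have hmul := endEigenPrimaryTorsion_two_characters_mul W hj K hθ π hrel hr g k
    (fun x hx hxk ↦ h₁ k x hx hxk N hN) (fun x hx hxk ↦ h₂ k x hx hxk N hN)
  have hNN : ((N * N : ℤ) : ℤ_[2]) - t * t ∈ (Ideal.span {(2 : ℤ_[2]) ^ k} : Ideal ℤ_[2]) := by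
    have : ((N * N : ℤ) : ℤ_[2]) - t * t = ((N : ℤ_[2]) - t) * ((N : ℤ_[2]) + t) := by push_cast; ring
    rw [this]
    exact Ideal.mul_mem_right _ _ hN
  have := Ideal.sub_mem _ hmul hNN
  rwa [sub_sub_sub_cancel_left] at this

/-- **A summand inside the datum is INFINITELY ramified** (the kernel-of-reduction type): if `g` acts on `E[𝔮'^∞][2^k]` as the
`2`-adic scalar `t` for every `k` and `t ≠ ±1`, then some `x` of some level has `g x ≠ ±x`. [cite: Rubin1999, §3 Lemma 3.6 (ii)] -/
theorem endEigenPrimaryTorsion_two_exists_smul_ne (hj : W.j = -3375) {θ : K} (hθ : θ ^ 2 = -7)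
    (π : (W.baseChange K).endRing) (hrel : (π : AddMonoid.End (W.baseChange K).geomPoints) * π = π - 2)
    {ρ : ℤ_[2]} (hρ : ρ * ρ = ρ - 2) (g : absoluteGaloisGroup K) {t : ℤ_[2]} (ht₁ : t ≠ 1) (ht₂ : t ≠ -1)
    (h : ∀ (k : ℕ), ∀ x ∈ (W.baseChange K).endEigenPrimaryTorsion 2 π ρ, 2 ^ k • x = 0 →
      ∀ N : ℤ, ((N : ℤ_[2]) - t) ∈ (Ideal.span {(2 : ℤ_[2]) ^ k} : Ideal ℤ_[2]) → g • x = N • x) :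
    ∃ (k : ℕ), ∃ x ∈ (W.baseChange K).endEigenPrimaryTorsion 2 π ρ, 2 ^ k • x = 0 ∧ g • x ≠ x ∧ g • x ≠ -x := by
  obtain ⟨-, -, -, -, -, -, hgen, -⟩ := endEigenPrimaryTorsion_two_structure W hj K hθ π hrel hρ
  -- a level `2^k` separating `t` from `±1`
  have hsep : ∀ {s : ℤ_[2]}, s ≠ 0 → ∃ k₀ : ℕ, ∀ k, k₀ ≤ k → s ∉ (Ideal.span {(2 : ℤ_[2]) ^ k} : Ideal ℤ_[2]) := by
    intro s hs
    refine ⟨s.valuation + 1, fun k hk hmem ↦ ?_⟩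
    have hk' : ‖s‖ ≤ ((2 : ℕ) : ℝ) ^ (-(k : ℤ)) := (PadicInt.norm_le_pow_iff_mem_span_pow _ _).mpr hmem
    rw [PadicInt.norm_eq_zpow_neg_valuation hs] at hk'
    have hlt : ((2 : ℕ) : ℝ) ^ (-(k : ℤ)) < ((2 : ℕ) : ℝ) ^ (-(s.valuation : ℤ)) :=
      zpow_lt_zpow_right₀ (by norm_num) (by omega)
    exact absurd (lt_of_lt_of_le hlt hk') (lt_irrefl _)
  obtain ⟨k₁, hk₁⟩ := hsep (sub_ne_zero.mpr ht₁)
  obtain ⟨k₂, hk₂⟩ := hsep (s := t + 1) (fun h0 ↦ ht₂ (eq_neg_of_add_eq_zero_left h0))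
  set k := k₁ + k₂ with hk
  obtain ⟨x, hxM, hord, -⟩ := hgen k
  have hxk : 2 ^ k • x = 0 := hord ▸ addOrderOf_nsmul_eq_zero x
  obtain ⟨N, hN⟩ := exists_int_sub_mem_span (p := 2) t k
  have hgx : g • x = N • x := h k x hxM hxk N hN
  refine ⟨k, x, hxM, hxk, ?_, ?_⟩
  · intro h1
    rw [hgx] at h1
    have hdvd : (addOrderOf x : ℤ) ∣ (N - 1) :=
      addOrderOf_dvd_iff_zsmul_eq_zero.mpr (by rw [sub_smul, one_smul, h1, sub_self])
    rw [hord] at hdvd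
    push_cast at hdvd
    have hmem := (intCast_mem_span_two_iff_dvd (N - 1) k).mpr hdvd
    have : t - 1 = ((N - 1 : ℤ) : ℤ_[2]) - ((N : ℤ_[2]) - t) := by push_cast; ring
    exact hk₁ k (Nat.le_add_right _ _) (this ▸ Ideal.sub_mem _ hmem hN)
  · intro h1
    rw [hgx] at h1
    have hdvd : (addOrderOf x : ℤ) ∣ (N + 1) :=
      addOrderOf_dvd_iff_zsmul_eq_zero.mpr (by rw [add_smul, one_smul, h1, neg_add_cancel])
    rw [hord] at hdvd
    push_cast at hdvd
    have hmem := (intCast_mem_span_two_iff_dvd (N + 1) k).mpr hdvd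
    have : t + 1 = ((N + 1 : ℤ) : ℤ_[2]) - ((N : ℤ_[2]) - t) := by push_cast; ring
    exact hk₂ k (Nat.le_add_left _ _) (this ▸ Ideal.sub_mem _ hmem hN)

end Core

/-! ## §3 The dichotomy relative to a Greenberg datum at `𝔭` -/
section Datum

open WeierstrassCurve Literature.NumberTheory.EllipticCurves Literature.NumberTheory.GaloisRepresentations Field NumberField
  IsDedekindDomain

variable (W : WeierstrassCurve ℚ) [W.IsElliptic] (K : Type) [Field K] [NumberField K]

/-- **LOCAL DICHOTOMY OF THE CM SUMMANDS RELATIVE TO A GREENBERG DATUM AT `𝔭 ∣ 2`.** `W/ℚ` elliptic with `j = −3375`, `K` a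
number field with `θ² = −7`, `π ∈ End_K(E_K)` with `π² = π − 2`, `r ∈ ℤ₂` a root of `X² − X + 2`, `𝔭` a finite place of `K`;
`C ≤ E_K[2^∞]`, `α ∈ ℤ₂ˣ` a datum carrying the two SIGNED clauses of p640618's `stub_ordinaryFiltrationAtTwo` for `Γ_{K_𝔭}`
(quotient `±αⁿ` graded modulo `C`, line `±ε·α^{−n}` on `C[2^k]`); `τ₀ ∈ Γ_{K_𝔭}` an inertia element (`IsFrobPow τ₀ 0`) with
`ε(res τ₀) ≠ 1`. Then the roots `{r, 1 − r}` are ORDERED `(ρ, ρ')` so that: `E[𝔮_ρ^∞] ⊄ C`, `E[𝔮_{ρ'}^∞] ≤ C`; every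
`σ ∈ Γ_{K_𝔭}` of Frobenius degree `n` acts on `E[𝔮_ρ^∞][2^k]` as any `N ≡ ±αⁿ (mod 2^k)` (UNRAMIFIED-TWIST type) and on
`E[𝔮_{ρ'}^∞][2^k]` as any `N ≡ ±ε(res σ)·α^{−n} (mod 2^k)` (KERNEL-OF-REDUCTION type), with the datum's signs. Proof: `C = ⊤`
or «both summands ⊄ C» would give one scalar `t` (`= ±ε(res τ₀)`, resp. `= ±1`) for `τ₀` on both summands, whence `t² = ε(res τ₀)`
by `ψ_𝔮ψ_𝔮̄ = ε`, i.e. `ε(res τ₀) = 1`. [cite: Rubin1999, §3 Lemma 3.6 (ii), Thm. 3.15 (ii), Cor. 3.17]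
[cite: GreenbergLNM1716, §2 p. 70] -/
theorem endEigenPrimaryTorsion_two_localTypes_of_datum (hj : W.j = -3375) {θ : K} (hθ : θ ^ 2 = -7)
    (π : (W.baseChange K).endRing) (hrel : (π : AddMonoid.End (W.baseChange K).geomPoints) * π = π - 2)
    {r : ℤ_[2]} (hr : r * r = r - 2) (𝔭 : HeightOneSpectrum (𝓞 K))
    (C : AddSubgroup ((W.baseChange K).geomPrimaryTorsion 2)) (α : ℤ_[2]ˣ)
    (hchar : ∀ (σ : absoluteGaloisGroup (𝔭.adicCompletion K)) (n : ℕ), IsFrobPow σ (n : ℤ) →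
      ∃ s₁ s₂ : ℤ, (s₁ = 1 ∨ s₁ = -1) ∧ (s₂ = 1 ∨ s₂ = -1) ∧
        (∀ (k : ℕ) (x : (W.baseChange K).geomPrimaryTorsion 2), 2 ^ k • x ∈ C →
          ∀ N : ℤ, ((N : ℤ_[2]) - s₂ * ((α ^ n : ℤ_[2]ˣ) : ℤ_[2])) ∈
              (Ideal.span {(2 : ℤ_[2]) ^ k} : Ideal ℤ_[2]) →
            absGaloisRestrict K (𝔭.adicCompletion K) σ • x - N • x ∈ C) ∧
        (∀ (k : ℕ) (c : (W.baseChange K).geomPrimaryTorsion 2), c ∈ C → 2 ^ k • c = 0 →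
          ∀ N : ℤ, ((N : ℤ_[2]) - s₁ *
              ((GaloisRep.cyclotomicCharacter K 2 (absGaloisRestrict K (𝔭.adicCompletion K) σ) * (α⁻¹) ^ n :
                ℤ_[2]ˣ) : ℤ_[2])) ∈ (Ideal.span {(2 : ℤ_[2]) ^ k} : Ideal ℤ_[2]) →
            absGaloisRestrict K (𝔭.adicCompletion K) σ • c = N • c))
    {τ₀ : absoluteGaloisGroup (𝔭.adicCompletion K)} (hτ₀ : IsFrobPow τ₀ 0)
    (hu : GaloisRep.cyclotomicCharacter K 2 (absGaloisRestrict K (𝔭.adicCompletion K) τ₀) ≠ 1) :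
    ∃ ρ ρ' : ℤ_[2], ((ρ = r ∧ ρ' = 1 - r) ∨ (ρ = 1 - r ∧ ρ' = r)) ∧
      ¬ (W.baseChange K).endEigenPrimaryTorsion 2 π ρ ≤ C ∧
      (W.baseChange K).endEigenPrimaryTorsion 2 π ρ' ≤ C ∧
      (∀ (σ : absoluteGaloisGroup (𝔭.adicCompletion K)) (n : ℕ), IsFrobPow σ (n : ℤ) →
        ∃ s : ℤ, (s = 1 ∨ s = -1) ∧
          ∀ (k : ℕ), ∀ x ∈ (W.baseChange K).endEigenPrimaryTorsion 2 π ρ, 2 ^ k • x = 0 →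
            ∀ N : ℤ, ((N : ℤ_[2]) - s * ((α ^ n : ℤ_[2]ˣ) : ℤ_[2])) ∈ (Ideal.span {(2 : ℤ_[2]) ^ k} : Ideal ℤ_[2]) →
              absGaloisRestrict K (𝔭.adicCompletion K) σ • x = N • x) ∧
      (∀ (σ : absoluteGaloisGroup (𝔭.adicCompletion K)) (n : ℕ), IsFrobPow σ (n : ℤ) →
        ∃ s : ℤ, (s = 1 ∨ s = -1) ∧
          ∀ (k : ℕ), ∀ x ∈ (W.baseChange K).endEigenPrimaryTorsion 2 π ρ', 2 ^ k • x = 0 →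
            ∀ N : ℤ, ((N : ℤ_[2]) - s *
                ((GaloisRep.cyclotomicCharacter K 2 (absGaloisRestrict K (𝔭.adicCompletion K) σ) * (α⁻¹) ^ n :
                  ℤ_[2]ˣ) : ℤ_[2])) ∈ (Ideal.span {(2 : ℤ_[2]) ^ k} : Ideal ℤ_[2]) →
              absGaloisRestrict K (𝔭.adicCompletion K) σ • x = N • x) := by
  have hr' : (1 - r) * (1 - r) = (1 - r) - 2 := by linear_combination hr
  obtain ⟨-, hsup, -, -, -, -, -, -⟩ := endEigenPrimaryTorsion_two_structure W hj K hθ π hrel hr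
  set g₀ := absGaloisRestrict K (𝔭.adicCompletion K) τ₀ with hg₀
  set u : ℤ_[2]ˣ := GaloisRep.cyclotomicCharacter K 2 g₀ with hu_def
  -- the datum clauses at the inertia element `τ₀` (Frobenius degree `0`)
  obtain ⟨s₁, s₂, hs₁, hs₂, hquot₀, hline₀⟩ := hchar τ₀ 0 (by exact_mod_cast hτ₀)
  simp only [pow_zero, Units.val_one, mul_one] at hquot₀ hline₀
  have hs₁sq : (s₁ : ℤ_[2]) * s₁ = 1 := by rcases hs₁ with rfl | rfl <;> push_cast <;> ring
  have hs₂sq : (s₂ : ℤ_[2]) * s₂ = 1 := by rcases hs₂ with rfl | rfl <;> push_cast <;> ring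
  -- (1) `C ≠ ⊤`
  have hCtop : C ≠ ⊤ := by
    intro hC
    have key := endEigenPrimaryTorsion_two_sq_eq_cyclotomicCharacter W K hj hθ π hrel hr g₀ (t := s₁ * (u : ℤ_[2]))
      (fun k x _ hxk N hN ↦ hline₀ k x (hC ▸ AddSubgroup.mem_top x) hxk N hN)
      (fun k x _ hxk N hN ↦ hline₀ k x (hC ▸ AddSubgroup.mem_top x) hxk N hN)
    have h1 : (u : ℤ_[2]) * (u : ℤ_[2]) = (u : ℤ_[2]) * 1 := by
      linear_combination key - (u : ℤ_[2]) * (u : ℤ_[2]) * hs₁sq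
    exact hu (Units.ext (mul_left_cancel₀ (Units.ne_zero u) h1))
  -- (2) not both summands outside `C`
  have hnotboth : ¬ (¬ (W.baseChange K).endEigenPrimaryTorsion 2 π r ≤ C ∧
      ¬ (W.baseChange K).endEigenPrimaryTorsion 2 π (1 - r) ≤ C) := by
    rintro ⟨h₁, h₂⟩
    have q₁ := endEigenPrimaryTorsion_two_smul_eq_of_not_le W K hj hθ π hrel hr h₁ g₀ hquot₀
    have q₂ := endEigenPrimaryTorsion_two_smul_eq_of_not_le W K hj hθ π hrel hr' h₂ g₀ hquot₀
    have key := endEigenPrimaryTorsion_two_sq_eq_cyclotomicCharacter W K hj hθ π hrel hr g₀ q₁ q₂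
    rw [hs₂sq] at key
    exact hu (Units.ext key.symm)
  -- (3) the dichotomy
  by_cases hle : (W.baseChange K).endEigenPrimaryTorsion 2 π r ≤ C
  · have hnot : ¬ (W.baseChange K).endEigenPrimaryTorsion 2 π (1 - r) ≤ C := by
      intro h
      have htop : (⊤ : AddSubgroup ((W.baseChange K).geomPrimaryTorsion 2)) ≤ C := hsup ▸ sup_le hle h
      exact hCtop (top_le_iff.mp htop)
    refine ⟨1 - r, r, Or.inr ⟨rfl, rfl⟩, hnot, hle, fun σ n hσ ↦ ?_, fun σ n hσ ↦ ?_⟩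
    · obtain ⟨-, s, -, hs, hquot, -⟩ := hchar σ n hσ
      exact ⟨s, hs, endEigenPrimaryTorsion_two_smul_eq_of_not_le W K hj hθ π hrel hr' hnot _ hquot⟩
    · obtain ⟨s, -, hs, -, -, hline⟩ := hchar σ n hσ
      exact ⟨s, hs, fun k x hx hxk N hN ↦ hline k x (hle hx) hxk N hN⟩
  · have hle' : (W.baseChange K).endEigenPrimaryTorsion 2 π (1 - r) ≤ C := by
      by_contra h
      exact hnotboth ⟨hle, h⟩
    refine ⟨r, 1 - r, Or.inl ⟨rfl, rfl⟩, hle, hle', fun σ n hσ ↦ ?_, fun σ n hσ ↦ ?_⟩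
    · obtain ⟨-, s, -, hs, hquot, -⟩ := hchar σ n hσ
      exact ⟨s, hs, endEigenPrimaryTorsion_two_smul_eq_of_not_le W K hj hθ π hrel hr hle _ hquot⟩
    · obtain ⟨s, -, hs, -, -, hline⟩ := hchar σ n hσ
      exact ⟨s, hs, fun k x hx hxk N hN ↦ hline k x (hle' hx) hxk N hN⟩

/-- **A `2`-DIVISIBLE Greenberg datum IS the kernel-type summand.** In the situation of
`endEigenPrimaryTorsion_two_localTypes_of_datum`: if moreover `C` is `2`-divisible (as Greenberg's reduction line
`(reductionDatum …).plus` is, `Rank1Residual.reductionDatum_divisible`), then `C = E[𝔮_{ρ'}^∞]` on the nose (`C = E[𝔮_{ρ'}^∞] ⊕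
(C ∩ E[𝔮_ρ^∞])` with a finite second summand, and a divisible group has no non-zero finite direct summand).
[cite: GreenbergLNM1716, §2 pp. 62–63] [cite: Rubin1999, §3 Lemma 3.6 (ii)] -/
theorem eq_endEigenPrimaryTorsion_two_of_divisible (hj : W.j = -3375) {θ : K} (hθ : θ ^ 2 = -7)
    (π : (W.baseChange K).endRing) (hrel : (π : AddMonoid.End (W.baseChange K).geomPoints) * π = π - 2)
    {ρ ρ' : ℤ_[2]} (hρ : ρ * ρ = ρ - 2) (hρ' : ρ' = 1 - ρ) {C : AddSubgroup ((W.baseChange K).geomPrimaryTorsion 2)}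
    (hnot : ¬ (W.baseChange K).endEigenPrimaryTorsion 2 π ρ ≤ C) (hle : (W.baseChange K).endEigenPrimaryTorsion 2 π ρ' ≤ C)
    (hdivC : ∀ c ∈ C, ∃ c' ∈ C, 2 • c' = c) :
    C = (W.baseChange K).endEigenPrimaryTorsion 2 π ρ' := by
  subst hρ'
  obtain ⟨-, hsup, -, -, -, -, -, -⟩ := endEigenPrimaryTorsion_two_structure W hj K hθ π hrel hρ
  obtain ⟨a, ha⟩ := endEigenPrimaryTorsion_two_exists_inf_le_torsionBy W K hj hθ π hrel hρ hnot
  refine le_antisymm (fun c hc ↦ ?_) hle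
  -- `c = 2^a d` with `d ∈ C`
  have hdivpow : ∀ n : ℕ, ∀ c ∈ C, ∃ d ∈ C, 2 ^ n • d = c := by
    intro n
    induction n with
    | zero => intro c hc; exact ⟨c, hc, by rw [pow_zero, one_nsmul]⟩
    | succ n ih =>
      intro c hc
      obtain ⟨d, hd, rfl⟩ := ih c hc
      obtain ⟨e, he, rfl⟩ := hdivC d hd
      exact ⟨e, he, by rw [pow_succ', mul_nsmul]⟩
  obtain ⟨d, hd, rfl⟩ := hdivpow a c hc
  -- `d = y + y'`, `y ∈ E[𝔮_ρ^∞]`, `y' ∈ E[𝔮_{ρ'}^∞] ≤ C`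
  have hd' : d ∈ (W.baseChange K).endEigenPrimaryTorsion 2 π ρ ⊔ (W.baseChange K).endEigenPrimaryTorsion 2 π (1 - ρ) :=
    hsup ▸ AddSubgroup.mem_top d
  obtain ⟨y, hy, y', hy', rfl⟩ := AddSubgroup.mem_sup.mp hd'
  have hyC : y ∈ C := by
    have := C.sub_mem hd (hle hy')
    rwa [add_sub_cancel_right] at this
  rw [nsmul_add, ha y hy hyC, zero_add]
  exact AddSubgroup.nsmul_mem _ hy' _

end Datum

end Summit.BirchSwinnertonDyer.BirchSwinnertonDyer.Theorems.PrintCf2.CMPrimes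

end
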